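import Summits.QuantumFields.QCD.Theorems.GaussianLinkFramesFrameFMClosureTwoStarOfPaddedAux5

/-!
# Crux `GaussianLinkFrames.FrameFMClosure` (stmt-QuantumFields-17375), line `pad-the-fibre`, stub
`stub_placementSides` — helper 1: cyclic offsets, domino flips on `ZMod N`, and coordinate charts of even boxes /
odd balls on the torus

The placement combinatorics of the (sides) hypothesis is one-dimensional once sites of the odd torus are read through
their per-coordinate OFFSETS `(u - p).val ∈ [0, N)` from a base residue `p`.  This file provides

* §1 offset arithmetic (`val` of `u ± k`, re-basing);
* §2 the DOMINO FLIP anchored at `p`, `u ↦ u + 1` if the offset of `u` is even and `u ↦ u - 1` otherwise: on every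
  offset window `[k₁, k₂]` with `k₁` even, `k₂` odd, `k₂ + 2 ≤ N` it is a nearest-neighbour involution
  (`flip_window`) — the single source of all pairings used by the side placements;
* §3 coordinate charts: membership in the image of an integer box `c + proj (∏ Icc lo hi)` — hence in
  `ebox S c r`, `ball S c r`, a pad `ebox S x' 1` — is a per-coordinate bound on an offset (`mem_ebox_iff_val`,
  `mem_ball_iff_val`).

References: elementary [folklore]; the pad recipe is the line card of `pad-the-fibre`.
-/

noncomputable section

open scoped BigOperators
open Literature.MathematicalPhysics.QuantumFieldTheory Literature.MathematicalPhysics.QuantumLattice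
  Literature.Probability.LatticeModels
open Summit.QuantumFields.QCD.Theorems.VonMisesCircles

namespace Summit.QuantumFields.QCD.Theorems.PadTheFibreTwoStar

/-! ## §1 Offset arithmetic on `ZMod N` -/

/-- `(u + k).val = u.val + k` when no wrap occurs. [folklore] -/
theorem val_add_natCast_of_lt {N : ℕ} [NeZero N] (u : ZMod N) (k : ℕ) (h : u.val + k < N) :
    (u + (k : ZMod N)).val = u.val + k := by
  have hk : (k : ZMod N).val = k := ZMod.val_cast_of_lt (by omega)
  rw [ZMod.val_add_of_lt (by rw [hk]; exact h), hk]

/-- `(u - k).val = u.val - k` when `k ≤ u.val`. [folklore] -/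
theorem val_sub_natCast_of_le {N : ℕ} [NeZero N] (u : ZMod N) (k : ℕ) (h : k ≤ u.val) :
    (u - (k : ZMod N)).val = u.val - k := by
  have hk : (k : ZMod N).val = k := ZMod.val_cast_of_lt (lt_of_le_of_lt h (ZMod.val_lt u))
  rw [ZMod.val_sub (by rw [hk]; exact h), hk]

/-- `(u + 1).val = u.val + 1` when `u.val + 1 < N`. [folklore] -/
theorem val_add_one_of_lt {N : ℕ} [NeZero N] (u : ZMod N) (h : u.val + 1 < N) : (u + 1).val = u.val + 1 := by
  have := val_add_natCast_of_lt u 1 h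
  simpa using this

/-- `(u - 1).val = u.val - 1` when `1 ≤ u.val`. [folklore] -/
theorem val_sub_one_of_le {N : ℕ} [NeZero N] (u : ZMod N) (h : 1 ≤ u.val) : (u - 1).val = u.val - 1 := by
  have := val_sub_natCast_of_le u 1 h
  simpa using this

/-- Re-basing offsets: the offset of `u` from `p` is the offset from `p'` plus the offset of `p'` from `p`,
modulo `N`. [folklore] -/
theorem val_sub_rebase {N : ℕ} [NeZero N] (u p p' : ZMod N) :
    (u - p).val = ((u - p').val + (p' - p).val) % N := by
  have : u - p = (u - p') + (p' - p) := by ring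
  rw [this, ZMod.val_add]

/-- Re-basing without wrap. [folklore] -/
theorem val_sub_rebase_of_lt {N : ℕ} [NeZero N] (u p p' : ZMod N) (h : (u - p').val + (p' - p).val < N) :
    (u - p).val = (u - p').val + (p' - p).val := by
  rw [val_sub_rebase u p p', Nat.mod_eq_of_lt h]

/-- Re-basing with one wrap. [folklore] -/
theorem val_sub_rebase_of_le {N : ℕ} [NeZero N] (u p p' : ZMod N) (h : N ≤ (u - p').val + (p' - p).val) :
    (u - p).val = (u - p').val + (p' - p).val - N := by
  rw [val_sub_rebase u p p']
  have h1 : (u - p').val < N := ZMod.val_lt _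
  have h2 : (p' - p).val < N := ZMod.val_lt _
  rw [Nat.mod_eq_sub_mod h, Nat.mod_eq_of_lt (by omega)]

/-- Offsets of `u` from `p` and of `p` from `u` add up to `N` (or both vanish). [folklore] -/
theorem val_sub_add_val_sub {N : ℕ} [NeZero N] (u p : ZMod N) :
    ((u - p).val = 0 ∧ (p - u).val = 0) ∨ (u - p).val + (p - u).val = N := by
  have h := ZMod.neg_val (u - p)
  rw [neg_sub] at h
  by_cases h0 : u - p = 0
  · left
    rw [if_pos h0] at h
    exact ⟨by rw [h0, ZMod.val_zero], h⟩
  · right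
    rw [if_neg h0] at h
    have : (u - p).val < N := ZMod.val_lt _
    omega

/-- Moving one step: offsets of `u + 1` and `u - 1`. [folklore] -/
theorem val_sub_add_one {N : ℕ} [NeZero N] (u p : ZMod N) (h : (u - p).val + 1 < N) :
    (u + 1 - p).val = (u - p).val + 1 := by
  rw [show u + 1 - p = (u - p) + 1 by ring]
  exact val_add_one_of_lt _ h

/-- Moving one step down. [folklore] -/
theorem val_sub_sub_one {N : ℕ} [NeZero N] (u p : ZMod N) (h : 1 ≤ (u - p).val) :
    (u - 1 - p).val = (u - p).val - 1 := by
  rw [show u - 1 - p = (u - p) - 1 by ring]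
  exact val_sub_one_of_le _ h

/-! ## §2 The domino flip anchored at a base residue -/

/-- **The domino flip on an offset window.**  Let `π u = u + 1` if the offset `(u - p).val` is even and
`π u = u - 1` otherwise.  If the offset of `u` lies in a window `[k₁, k₂]` with `k₁` even, `k₂` odd and
`k₂ + 2 ≤ N`, then `π u` lies in the same window, `π (π u) = u`, and `π u` is a `±1`-neighbour of `u`; moreover the
offset of `π u` is the offset of `u` with its last bit flipped. [folklore] -/
theorem flip_window {N : ℕ} [NeZero N] (p : ZMod N) (k₁ k₂ : ℕ) (hk₁ : Even k₁) (hk₂ : Odd k₂)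
    (hN : k₂ + 2 ≤ N) (u : ZMod N) (hu₁ : k₁ ≤ (u - p).val) (hu₂ : (u - p).val ≤ k₂) :
    let π : ZMod N → ZMod N := fun v => if Even (v - p).val then v + 1 else v - 1
    k₁ ≤ (π u - p).val ∧ (π u - p).val ≤ k₂ ∧ π (π u) = u ∧ (π u = u + 1 ∨ u = π u + 1) ∧
      ((Even (u - p).val ∧ π u = u + 1 ∧ (π u - p).val = (u - p).val + 1) ∨
        (¬ Even (u - p).val ∧ π u = u - 1 ∧ (π u - p).val + 1 = (u - p).val)) := by
  intro π
  obtain ⟨m₁, hm₁⟩ := hk₁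
  obtain ⟨m₂, hm₂⟩ := hk₂
  by_cases he : Even (u - p).val
  · have h1 : π u = u + 1 := if_pos he
    obtain ⟨m, hm⟩ := he
    have hlt : (u - p).val + 1 < N := by omega
    have hv : (u + 1 - p).val = (u - p).val + 1 := val_sub_add_one u p hlt
    have hne : ¬ Even (u + 1 - p).val := by rw [hv]; rintro ⟨m', hm'⟩; omega
    have h2 : π (u + 1) = u + 1 - 1 := if_neg hne
    refine ⟨by rw [h1, hv]; omega, by rw [h1, hv]; omega, by rw [h1, h2]; ring, Or.inl h1, Or.inl ⟨⟨m, hm⟩, h1, ?_⟩⟩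
    rw [h1, hv]
  · have h1 : π u = u - 1 := if_neg he
    have hge : 1 ≤ (u - p).val := by
      rcases Nat.eq_zero_or_pos (u - p).val with h0 | h0
      · exact (he ⟨0, by rw [h0]⟩).elim
      · exact h0
    have hv : (u - 1 - p).val = (u - p).val - 1 := val_sub_sub_one u p hge
    have hev : Even (u - 1 - p).val := by
      rw [hv]
      rcases Nat.even_or_odd (u - p).val with h | ⟨m, hm⟩
      · exact (he h).elim
      · exact ⟨m, by omega⟩
    have h2 : π (u - 1) = u - 1 + 1 := if_pos hev
    have hodd : (u - p).val % 2 = 1 := Nat.odd_iff.mp (Nat.not_even_iff_odd.mp he)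
    refine ⟨by rw [h1, hv]; omega, by rw [h1, hv]; omega, by rw [h1, h2]; ring, Or.inr (by rw [h1]; ring),
      Or.inr ⟨he, h1, ?_⟩⟩
    rw [h1, hv]; omega

/-! ## §3 Coordinate charts of integer boxes on the torus -/

/-- **Chart of an integer box.**  For `0 ≤ m`, `0 ≤ n`, `m + n < N`: a site `y` lies in the image of the box
`∏ Icc (-m) n` translated by `c` iff every coordinate offset `(y i - c i + m).val` is at most `m + n`. [folklore] -/
theorem mem_image_box_iff_val {N : ℕ} [NeZero N] (c y : TorusSite 4 N) (m n : ℕ) (hmn : m + n < N) :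
    y ∈ (Fintype.piFinset fun _ : Fin 4 => Finset.Icc (-(m : ℤ)) n).image
        (fun w => c + Torus.proj N w) ↔
      ∀ i, (y i - c i + (m : ZMod N)).val ≤ m + n := by
  constructor
  · rintro h i
    rw [Finset.mem_image] at h
    obtain ⟨w, hw, rfl⟩ := h
    rw [Fintype.mem_piFinset] at hw
    have hwi := Finset.mem_Icc.1 (hw i)
    have e : (c + Torus.proj N w) i - c i + (m : ZMod N) = (((w i + m).toNat : ℕ) : ZMod N) := by
      rw [← Int.cast_natCast ((w i + ↑m).toNat), Int.toNat_of_nonneg (by omega)]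
      simp only [Pi.add_apply, Torus.proj_apply, add_sub_cancel_left]
      push_cast; ring
    rw [e, ZMod.val_cast_of_lt (by omega)]
    omega
  · intro h
    rw [Finset.mem_image]
    refine ⟨fun i => ((y i - c i + (m : ZMod N)).val : ℤ) - m, ?_, ?_⟩
    · rw [Fintype.mem_piFinset]
      intro i
      rw [Finset.mem_Icc]
      have := h i
      constructor <;> omega
    · funext i
      simp only [Pi.add_apply, Torus.proj_apply]
      push_cast
      rw [ZMod.natCast_zmod_val]
      ring

/-- **Chart of the even box** `ebox S c r` (`r + 1 ≤ S`... in fact `2r + 2 ≤ 2S+1`): `y ∈ ebox S c r` iff every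
coordinate offset `(y i - c i + (r+1)).val ≤ 2r + 1`. [folklore] -/
theorem mem_ebox_iff_val {S : ℕ} (c y : TorusSite 4 (2 * S + 1)) (r : ℕ) (hr : r + 1 ≤ S) :
    y ∈ ebox S c r ↔ ∀ i, (y i - c i + ((r + 1 : ℕ) : ZMod (2 * S + 1))).val ≤ 2 * r + 1 := by
  haveI : NeZero (2 * S + 1) := ⟨by omega⟩
  have h := mem_image_box_iff_val c y (r + 1) r (by omega)
  have e : (Fintype.piFinset fun _ : Fin 4 => Finset.Icc (-((r + 1 : ℕ) : ℤ)) (r : ℕ)) =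
      (Fintype.piFinset fun _ : Fin 4 => Finset.Icc (-(r : ℤ) - 1) r) := by
    congr 1; funext i; congr 1; push_cast; ring
  rw [e] at h
  unfold ebox
  rw [h]
  constructor <;> intro h' i <;> have := h' i <;> omega

/-- **Chart of a pad** `ebox S x' 1` (`2 ≤ S`): `y ∈ ebox S x' 1` iff every offset `(y i - x' i + 2).val ≤ 3`.
[folklore] -/
theorem mem_pad_iff_val {S : ℕ} (hS : 2 ≤ S) (x' y : TorusSite 4 (2 * S + 1)) :
    y ∈ ebox S x' 1 ↔ ∀ i, (y i - x' i + 2).val ≤ 3 := by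
  have h := mem_ebox_iff_val x' y 1 (by omega)
  have e : ((1 + 1 : ℕ) : ZMod (2 * S + 1)) = 2 := by push_cast; norm_num
  rw [e] at h
  exact h

/-- **Chart of the odd ball** `ball S c r` (`r ≤ S`): `y ∈ ball S c r` iff every offset `(y i - c i + r).val ≤ 2r`.
[folklore] -/
theorem mem_ball_iff_val {S : ℕ} (c y : TorusSite 4 (2 * S + 1)) (r : ℕ) (hr : r ≤ S) :
    y ∈ ball S c r ↔ ∀ i, (y i - c i + (r : ZMod (2 * S + 1))).val ≤ 2 * r := by
  haveI : NeZero (2 * S + 1) := ⟨by omega⟩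
  have h := mem_image_box_iff_val c y r r (by omega)
  unfold ball box
  rw [h]
  constructor <;> intro h' i <;> have := h' i <;> omega

/-- The `0`-core of a pad in the chart: `y ∈ ebox S x' 0` iff every offset `(y i - x' i + 1).val ≤ 1`. [folklore] -/
theorem mem_core_iff_val {S : ℕ} (hS : 1 ≤ S) (x' y : TorusSite 4 (2 * S + 1)) :
    y ∈ ebox S x' 0 ↔ ∀ i, (y i - x' i + 1).val ≤ 1 := by
  have h := mem_ebox_iff_val x' y 0 (by omega)
  have e : ((0 + 1 : ℕ) : ZMod (2 * S + 1)) = 1 := by push_cast; norm_num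
  rw [e] at h
  simpa using h

/-- Coordinates of a shifted site: `(y + e_μ) i = y i + 1` if `i = μ`, else `y i`; and the same for `y - e_μ`.
[folklore] -/
theorem add_single_apply {N : ℕ} (y : TorusSite 4 N) (μ i : Fin 4) :
    (y + (Pi.single μ 1 : TorusSite 4 N)) i = (if i = μ then y i + 1 else y i) ∧
      (y - (Pi.single μ 1 : TorusSite 4 N)) i = (if i = μ then y i - 1 else y i) := by
  by_cases h : i = μ
  · subst h; simp
  · simp [h]

/-- **Registered helper `stub_placementSides_aux1` of crux stmt-QuantumFields-17375** (line `pad-the-fibre`, stub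
`stub_placementSides`): the coordinate chart of the even box — membership in `ebox S c r` is a per-coordinate bound
on a cyclic offset (the reduction of the placement combinatorics to one dimension). [folklore] -/
theorem stub_placementSides_aux1 : ∀ (S : ℕ) (c y : TorusSite 4 (2 * S + 1)) (r : ℕ), r + 1 ≤ S → (y ∈ ebox S c r ↔ ∀ i, (y i - c i + ((r + 1 : ℕ) : ZMod (2 * S + 1))).val ≤ 2 * r + 1) :=
  fun _ c y r hr => mem_ebox_iff_val c y r hr

end Summit.QuantumFields.QCD.Theorems.PadTheFibreTwoStar

end
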